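import Literature.Geometry.Lorentzian.ConformalChange
import Literature.Geometry.Lorentzian.CoordConstraintBridge
import HarnessLib

/-!
# Pulling bilinear-form fields back and forth along a chart and its inverse

Topic `Literature/Geometry/Lorentzian`. Everything here is PROVED; no definition, no statement of
`Prop` type is introduced.

Plumbing for local constructions on a `3`-manifold `X` that are carried out in a chart
`c = chartAt E3 x` (e.g. the reassembly step of the named fact
`ChruscielDelay_localConstraintDeformation`, `LocalConstraintDeformation.lean`: deformed data are
produced as coordinate fields on the chart target and transported back to `X`). With
`U = c.target` (an `Opens E3`) and the inverse chart `Φ : U → X`, `Φ u = c.symm u` (smooth with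
injective differentials, `ChartInverse.contMDiff_symm`, `injective_mfderiv_symm` of
`ConformalChange.lean`):

* `ChartInverse.mfderiv_chart_comp_mfderiv_symm` — `dc_{Φ u} ∘ dΦ_u = id_{E3}`;
  `mfderiv_symm_comp_mfderiv_chart` — `dΦ_u ∘ dc_{Φ u} = id` (finite dimension);
  `mfderiv_symm_mfderiv_chart_apply` — the same at a point `p` of the chart source
  (`u = c p`);
* `ChartInverse.pullbackBilin_symm_pullbackBilin_chart` — **`Φ^* (c^* S) = S` on `U`** for a field
  `S` of bilinear forms on `E3`; `pullbackBilin_chart_coordHOn_comap`, `pullbackBilin_chart_coordKOn_comap`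
  — **`c^* (Φ^* D) = D` on the chart source** for an initial data set `D` on `X` (the coordinate
  readings `coordHOn`, `coordKOn` of `Φ^* D = D.comap Φ`, pulled back along `c`, are the sections
  of `D`);
* `PseudoRiemannianMetric.contMDiffAt_pullbackBilin_family` — the pointwise (`ContMDiffAt`) form
  of `contMDiff_pullbackBilin_family` (`DataFamilyComap.lean`): **the pullback along a map `f`,
  `C^{n+1}` at `y₀`, of a family of sections jointly `C^n` at `(p₀, f y₀)` is jointly `C^n` at
  `(p₀, y₀)`** — the form needed for maps smooth only on an open set, such as charts.

## References

* B. O'Neill, *Semi-Riemannian geometry* (1983), Ch. 3, Def. 3.9, Lemma 3.35. [ONeill1983]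
* R. Bartnik, J. Isenberg, *The constraint equations* (2004), §2. [BartnikIsenberg2004]
-/

noncomputable section

open Bundle Set Function Filter Manifold TopologicalSpace
open scoped Manifold ContDiff Topology

namespace Literature.Geometry.Lorentzian

/-! ### Pointwise smoothness of pulled-back families of sections -/

namespace PseudoRiemannianMetric

variable {E : Type*} [NormedAddCommGroup E] [NormedSpace ℝ E] {H : Type*} [TopologicalSpace H]
  {I : ModelWithCorners ℝ E H} {M : Type*} [TopologicalSpace M] [ChartedSpace H M]
  {E' : Type*} [NormedAddCommGroup E'] [NormedSpace ℝ E'] {H' : Type*} [TopologicalSpace H']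
  {I' : ModelWithCorners ℝ E' H'} {N : Type*} [TopologicalSpace N] [ChartedSpace H' N]
  {EP : Type*} [NormedAddCommGroup EP] [NormedSpace ℝ EP] {HP : Type*} [TopologicalSpace HP]
  {IP : ModelWithCorners ℝ EP HP} {P : Type*} [TopologicalSpace P] [ChartedSpace HP P]

/-- **Pointwise form of `contMDiff_pullbackBilin_family`.** If `f : N → M` is `C^{n+1}` at `y₀`
and the family of sections `(p, x) ↦ s p x` of the bundle of bilinear forms on `TM` is jointly
`C^n` at `(p₀, f y₀)`, then `(p, y) ↦ f^*(s p)(y)` is jointly `C^n` at `(p₀, y₀)` (same proof: in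
tangent coordinates `f^* s_p = (Df)ᵀ (s_p ∘ f) (Df)`). O'Neill 1983, Ch. 3, Def. 3.9.
[cite: ONeill1983, Ch. 3, Def. 3.9 and Lemma 3.35] -/
theorem contMDiffAt_pullbackBilin_family [IsManifold I' ∞ N] [IsManifold I ∞ M] {n : ℕ∞ω}
    {f : N → M} {q₀ : P × N} (hf : ContMDiffAt I' I (n + 1) f q₀.2)
    {s : P → Π x : M, TangentSpace I x →L[ℝ] TangentSpace I x →L[ℝ] ℝ}
    (hs : ContMDiffAt (IP.prod I) (I.prod 𝓘(ℝ, E →L[ℝ] E →L[ℝ] ℝ)) n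
      (fun q : P × M ↦ TotalSpace.mk' (E →L[ℝ] E →L[ℝ] ℝ)
        (E := fun x : M ↦ TangentSpace I x →L[ℝ] TangentSpace I x →L[ℝ] ℝ) q.2 (s q.1 q.2))
      (q₀.1, f q₀.2)) :
    ContMDiffAt (IP.prod I') (I'.prod 𝓘(ℝ, E' →L[ℝ] E' →L[ℝ] ℝ)) n
      (fun q : P × N ↦ TotalSpace.mk' (E' →L[ℝ] E' →L[ℝ] ℝ)
        (E := fun y : N ↦ TangentSpace I' y →L[ℝ] TangentSpace I' y →L[ℝ] ℝ) q.2
        (pullbackBilin (I := I) (I' := I') f (s q.1) q.2)) q₀ := by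
  rw [contMDiffAt_bilin_iff]
  refine ⟨contMDiffAt_snd, ?_⟩
  set τN := trivializationAt E' (TangentSpace I' : N → Type _) q₀.2 with hτN
  set τM := trivializationAt E (TangentSpace I : M → Type _) (f q₀.2) with hτM
  set Φ : N → E' →L[ℝ] E := inTangentCoordinates I' I id f (fun y ↦ mfderiv I' I f y) q₀.2 with hΦ
  have hΦs : ContMDiffAt I' 𝓘(ℝ, E' →L[ℝ] E) n Φ q₀.2 := ContMDiffAt.mfderiv_const hf le_rfl
  have hΦs' : ContMDiffAt (IP.prod I') 𝓘(ℝ, E' →L[ℝ] E) n (fun q : P × N ↦ Φ q.2) q₀ :=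
    hΦs.comp q₀ contMDiffAt_snd
  set β : P × M → E →L[ℝ] E →L[ℝ] ℝ := fun q ↦
    (ContinuousLinearMap.precomp ℝ (τM.symmL ℝ q.2)).comp ((s q.1 q.2).comp (τM.symmL ℝ q.2))
    with hβ
  have hβs : ContMDiffAt (IP.prod I) 𝓘(ℝ, E →L[ℝ] E →L[ℝ] ℝ) n β (q₀.1, f q₀.2) :=
    ((contMDiffAt_bilin_iff (IX := IP.prod I) (IB := I) (V := (TangentSpace I : M → Type _))
      (b := Prod.snd) (s := fun q : P × M ↦ s q.1 q.2) (x₀ := (q₀.1, f q₀.2))).1 hs).2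
  have hf' : ContMDiffAt I' I n f q₀.2 := hf.of_le le_self_add
  have hι : ContMDiffAt (IP.prod I') (IP.prod I) n (fun q : P × N ↦ (q.1, f q.2)) q₀ :=
    contMDiffAt_fst.prodMk (hf'.comp q₀ contMDiffAt_snd)
  have hβf : ContMDiffAt (IP.prod I') 𝓘(ℝ, E →L[ℝ] E →L[ℝ] ℝ) n
      (fun q : P × N ↦ β (q.1, f q.2)) q₀ :=
    ContMDiffAt.comp q₀ hβs hι
  have h1 : ContMDiffAt (IP.prod I') 𝓘(ℝ, E' →L[ℝ] E →L[ℝ] ℝ) n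
      (fun q : P × N ↦ (β (q.1, f q.2)).comp (Φ q.2)) q₀ :=
    ContMDiffAt.clm_comp hβf hΦs'
  have h2 : ContMDiffAt (IP.prod I') 𝓘(ℝ, (E →L[ℝ] ℝ) →L[ℝ] (E' →L[ℝ] ℝ)) n
      (fun q : P × N ↦ (Φ q.2).precomp ℝ) q₀ :=
    hΦs'.clm_precomp (F₃ := ℝ)
  have hcomp : ContMDiffAt (IP.prod I') 𝓘(ℝ, E' →L[ℝ] E' →L[ℝ] ℝ) n
      (fun q : P × N ↦ ((Φ q.2).precomp ℝ).comp ((β (q.1, f q.2)).comp (Φ q.2))) q₀ :=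
    ContMDiffAt.clm_comp h2 h1
  refine hcomp.congr_of_eventuallyEq ?_
  have hev : ∀ᶠ q : P × N in 𝓝 q₀, f q.2 ∈ τM.baseSet :=
    (hf.continuousAt.comp continuousAt_snd).preimage_mem_nhds
      (τM.open_baseSet.mem_nhds (FiberBundle.mem_baseSet_trivializationAt' (f q₀.2)))
  filter_upwards [hev] with q hfq
  ext e e'
  have key : ∀ v : E', τM.symmL ℝ (f q.2) (Φ q.2 v) = mfderiv I' I f q.2 (τN.symmL ℝ q.2 v) := by
    intro v
    simp only [hΦ, inTangentCoordinates, ContinuousLinearMap.inCoordinates,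
      ContinuousLinearMap.coe_comp, comp_apply, id_eq]
    exact τM.symmL_continuousLinearMapAt hfq _
  simp only [ContinuousLinearMap.coe_comp, comp_apply, ContinuousLinearMap.precomp_apply,
    pullbackBilin_apply, hβ, key]
  rfl

end PseudoRiemannianMetric

/-! ### The chart and its inverse: differentials and pullbacks -/

namespace ChartInverse

variable {X : Type*} [TopologicalSpace X] [ChartedSpace E3 X] [IsManifold (𝓡 3) ∞ X] (x : X)

/-- **`dc ∘ dΦ = id`**: the differential of the chart after that of the inverse chart is the
identity of `E3` (chain rule for `c ∘ Φ = Subtype.val`). [folklore] -/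
theorem mfderiv_chart_comp_mfderiv_symm :
    ∀ u : (⟨(chartAt E3 x).target, (chartAt E3 x).open_target⟩ : Opens E3),
      (mfderiv (𝓡 3) 𝓘(ℝ, E3) (chartAt E3 x) ((chartAt E3 x).symm u)).comp
        (mfderiv 𝓘(ℝ, E3) (𝓡 3)
          (fun u : (⟨(chartAt E3 x).target, (chartAt E3 x).open_target⟩ : Opens E3) ↦
            (chartAt E3 x).symm u) u) = ContinuousLinearMap.id ℝ E3 := by
  set U : Opens E3 := ⟨(chartAt E3 x).target, (chartAt E3 x).open_target⟩ with hU
  set Φ : U → X := fun u ↦ (chartAt E3 x).symm u with hΦ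
  intro u
  have hmem : Φ u ∈ (chartAt E3 x).source := (chartAt E3 x).map_target u.2
  have hΦd : MDifferentiableAt 𝓘(ℝ, E3) (𝓡 3) Φ u :=
    ((contMDiff_symm x).of_le le_self_add u).mdifferentiableAt (by simp)
  have hψd : MDifferentiableAt (𝓡 3) 𝓘(ℝ, E3) (chartAt E3 x) (Φ u) :=
    (((contMDiffOn_chart (I := 𝓡 3) (x := x) (n := ∞)).contMDiffAt
      ((chartAt E3 x).open_source.mem_nhds hmem))).mdifferentiableAt (by simp)
  have hcomp : mfderiv 𝓘(ℝ, E3) 𝓘(ℝ, E3) ((chartAt E3 x) ∘ Φ) u =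
      (mfderiv (𝓡 3) 𝓘(ℝ, E3) (chartAt E3 x) (Φ u)).comp (mfderiv 𝓘(ℝ, E3) (𝓡 3) Φ u) :=
    mfderiv_comp u hψd hΦd
  have hid : (chartAt E3 x) ∘ Φ = (Subtype.val : U → E3) := by
    funext u'
    exact (chartAt E3 x).right_inv u'.2
  have hval : mfderiv 𝓘(ℝ, E3) 𝓘(ℝ, E3) (Subtype.val : U → E3) u =
      ContinuousLinearMap.id ℝ E3 := by
    have := OpensChart.mfderiv_eq (U := U) (F := E3) u Subtype.val id (fun _ ↦ rfl)
      differentiableAt_id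
    rw [fderiv_id] at this
    exact this
  have key : (mfderiv (𝓡 3) 𝓘(ℝ, E3) (chartAt E3 x) (Φ u)).comp (mfderiv 𝓘(ℝ, E3) (𝓡 3) Φ u) =
      ContinuousLinearMap.id ℝ E3 := by
    rw [← hcomp, hid, hval]
  exact key

/-- `dc (dΦ v) = v`. [folklore] -/
theorem mfderiv_chart_mfderiv_symm_apply
    (u : (⟨(chartAt E3 x).target, (chartAt E3 x).open_target⟩ : Opens E3)) (v : E3) :
    mfderiv (𝓡 3) 𝓘(ℝ, E3) (chartAt E3 x) ((chartAt E3 x).symm u)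
      (mfderiv 𝓘(ℝ, E3) (𝓡 3)
        (fun u : (⟨(chartAt E3 x).target, (chartAt E3 x).open_target⟩ : Opens E3) ↦
          (chartAt E3 x).symm u) u v) = v := by
  have h := congrArg (fun f : E3 →L[ℝ] E3 ↦ f v) (mfderiv_chart_comp_mfderiv_symm x u)
  exact h

/-- **`dΦ ∘ dc = id`** on `T_{Φ u} X = E3` (a one-sided inverse of an endomorphism of a
finite-dimensional space is two-sided). [folklore] -/
theorem mfderiv_symm_mfderiv_chart_apply'
    (u : (⟨(chartAt E3 x).target, (chartAt E3 x).open_target⟩ : Opens E3)) (w : E3) :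
    mfderiv 𝓘(ℝ, E3) (𝓡 3)
        (fun u : (⟨(chartAt E3 x).target, (chartAt E3 x).open_target⟩ : Opens E3) ↦
          (chartAt E3 x).symm u) u
      (mfderiv (𝓡 3) 𝓘(ℝ, E3) (chartAt E3 x) ((chartAt E3 x).symm u) w) = w := by
  set A : E3 →L[ℝ] E3 := (show E3 →L[ℝ] E3 from
    mfderiv (𝓡 3) 𝓘(ℝ, E3) (chartAt E3 x) ((chartAt E3 x).symm u)) with hA
  set B : E3 →L[ℝ] E3 := (show E3 →L[ℝ] E3 from mfderiv 𝓘(ℝ, E3) (𝓡 3)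
    (fun u : (⟨(chartAt E3 x).target, (chartAt E3 x).open_target⟩ : Opens E3) ↦
      (chartAt E3 x).symm u) u) with hB
  have hAB : ∀ v : E3, A (B v) = v := mfderiv_chart_mfderiv_symm_apply x u
  -- `B` is injective, hence surjective
  have hBi : Function.Injective B := fun v₁ v₂ h ↦ by
    have := congrArg A h
    rwa [hAB, hAB] at this
  have hBs : Function.Surjective B :=
    (LinearMap.injective_iff_surjective (f := (B : E3 →ₗ[ℝ] E3))).1 hBi
  obtain ⟨v, rfl⟩ := hBs w
  show B (A (B v)) = B v
  rw [hAB]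

/-- **`dΦ_{c p} (dc_p v) = v`** at a point `p` of the chart source. [folklore] -/
theorem mfderiv_symm_mfderiv_chart_apply {p : X} (hp : p ∈ (chartAt E3 x).source)
    (v : TangentSpace (𝓡 3) p) :
    mfderiv 𝓘(ℝ, E3) (𝓡 3)
        (fun u : (⟨(chartAt E3 x).target, (chartAt E3 x).open_target⟩ : Opens E3) ↦
          (chartAt E3 x).symm u) ⟨chartAt E3 x p, (chartAt E3 x).map_source hp⟩
      (mfderiv (𝓡 3) 𝓘(ℝ, E3) (chartAt E3 x) p v) = v := by
  set u : (⟨(chartAt E3 x).target, (chartAt E3 x).open_target⟩ : Opens E3) :=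
    ⟨chartAt E3 x p, (chartAt E3 x).map_source hp⟩ with hu
  have hpu : (chartAt E3 x).symm (u : E3) = p := (chartAt E3 x).left_inv hp
  have key : (show E3 →L[ℝ] E3 from mfderiv (𝓡 3) 𝓘(ℝ, E3) (chartAt E3 x)
      ((chartAt E3 x).symm (u : E3))) =
      (show E3 →L[ℝ] E3 from mfderiv (𝓡 3) 𝓘(ℝ, E3) (chartAt E3 x) p) :=
    congrArg (fun q : X ↦ (show E3 →L[ℝ] E3 from mfderiv (𝓡 3) 𝓘(ℝ, E3) (chartAt E3 x) q)) hpu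
  have h := mfderiv_symm_mfderiv_chart_apply' x u v
  have key' : ∀ w : E3, (mfderiv (𝓡 3) 𝓘(ℝ, E3) (chartAt E3 x) ((chartAt E3 x).symm (u : E3))) w =
      (mfderiv (𝓡 3) 𝓘(ℝ, E3) (chartAt E3 x) p) w := fun w ↦
    congrArg (fun f : E3 →L[ℝ] E3 ↦ f w) key
  rw [key'] at h
  exact h

/-- **`Φ^*(c^* S) = S` on the chart target**: pulling a field `S` of bilinear forms on `E3` back
along the chart and then along the inverse chart gives `S` back at every `u ∈ c.target`.
[folklore] -/
theorem pullbackBilin_symm_pullbackBilin_chart (S : E3 → E3 →L[ℝ] E3 →L[ℝ] ℝ)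
    (u : (⟨(chartAt E3 x).target, (chartAt E3 x).open_target⟩ : Opens E3)) :
    pullbackBilin (I := 𝓡 3) (I' := 𝓘(ℝ, E3))
      (fun u : (⟨(chartAt E3 x).target, (chartAt E3 x).open_target⟩ : Opens E3) ↦
        (chartAt E3 x).symm u)
      (pullbackBilin (I := 𝓘(ℝ, E3)) (I' := 𝓡 3) (chartAt E3 x) S) u = S u := by
  ext v w
  simp only [pullbackBilin_apply, mfderiv_chart_mfderiv_symm_apply]
  rw [(chartAt E3 x).right_inv u.2]
  rfl

variable (D : InitialDataSet (𝓡 3) X)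

/-- **`c^*(Φ^* h) = h` on the chart source**: the coordinate reading `coordHOn` of the metric of
`Φ^* D` (`InitialDataSet.comap` along the inverse chart), pulled back along the chart, is the
metric of `D` at every point of the chart source. [cite: BartnikIsenberg2004, §2] -/
theorem pullbackBilin_chart_coordHOn_comap {p : X} (hp : p ∈ (chartAt E3 x).source) :
    pullbackBilin (I := 𝓘(ℝ, E3)) (I' := 𝓡 3) (chartAt E3 x)
      ((D.comap _ (contMDiff_symm x) (injective_mfderiv_symm x)).coordHOn) p = D.h.inner p := by
  have hcp : chartAt E3 x p ∈ (chartAt E3 x).target := (chartAt E3 x).map_source hp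
  have hpu : (chartAt E3 x).symm (chartAt E3 x p) = p := (chartAt E3 x).left_inv hp
  ext v w
  rw [pullbackBilin_apply, InitialDataSet.coordHOn_of_mem _ hcp]
  change (D.comap _ (contMDiff_symm x) (injective_mfderiv_symm x)).h.inner
      ⟨chartAt E3 x p, hcp⟩ (mfderiv (𝓡 3) 𝓘(ℝ, E3) (chartAt E3 x) p v)
      (mfderiv (𝓡 3) 𝓘(ℝ, E3) (chartAt E3 x) p w) = D.h.inner p v w
  rw [InitialDataSet.comap_h_inner, mfderiv_symm_mfderiv_chart_apply x hp,
    mfderiv_symm_mfderiv_chart_apply x hp]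
  exact congrArg (fun q : X ↦ (show E3 →L[ℝ] E3 →L[ℝ] ℝ from D.h.inner q) v w) hpu

/-- **`c^*(Φ^* k) = k` on the chart source** (same for the tensor `k`).
[cite: BartnikIsenberg2004, §2] -/
theorem pullbackBilin_chart_coordKOn_comap {p : X} (hp : p ∈ (chartAt E3 x).source) :
    pullbackBilin (I := 𝓘(ℝ, E3)) (I' := 𝓡 3) (chartAt E3 x)
      ((D.comap _ (contMDiff_symm x) (injective_mfderiv_symm x)).coordKOn) p = D.k p := by
  have hcp : chartAt E3 x p ∈ (chartAt E3 x).target := (chartAt E3 x).map_source hp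
  have hpu : (chartAt E3 x).symm (chartAt E3 x p) = p := (chartAt E3 x).left_inv hp
  ext v w
  rw [pullbackBilin_apply, InitialDataSet.coordKOn_of_mem _ hcp]
  change (D.comap _ (contMDiff_symm x) (injective_mfderiv_symm x)).k
      ⟨chartAt E3 x p, hcp⟩ (mfderiv (𝓡 3) 𝓘(ℝ, E3) (chartAt E3 x) p v)
      (mfderiv (𝓡 3) 𝓘(ℝ, E3) (chartAt E3 x) p w) = D.k p v w
  rw [InitialDataSet.comap_k, mfderiv_symm_mfderiv_chart_apply x hp,
    mfderiv_symm_mfderiv_chart_apply x hp]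
  exact congrArg (fun q : X ↦ (show E3 →L[ℝ] E3 →L[ℝ] ℝ from D.k q) v w) hpu

/-- **Pulling a jointly smooth family of coordinate fields back along the chart gives a jointly
smooth family of sections over the chart source**: if `(c', z) ↦ S c' z` is `C^∞` at
`(c₀, c p₀)`, `p₀ ∈ c.source`, then `(c', p) ↦ (c^* S_{c'})_p` is a jointly `C^∞` family of
sections of the bilinear-form bundle of `X` at `(c₀, p₀)` (`contMDiffAt_pullbackBilin_family`
with `f = c`, smooth near `p₀`; sections over `E3` are plain functions,
`contMDiffAt_bilinE3_iff`). [folklore] -/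
theorem contMDiffAt_pullbackBilin_chart_family {m : ℕ}
    {S : EuclideanSpace ℝ (Fin m) → E3 → E3 →L[ℝ] E3 →L[ℝ] ℝ} {c₀ : EuclideanSpace ℝ (Fin m)}
    {p₀ : X} (hp₀ : p₀ ∈ (chartAt E3 x).source)
    (hS : ContDiffAt ℝ ∞ (fun q : EuclideanSpace ℝ (Fin m) × E3 ↦ S q.1 q.2)
      (c₀, chartAt E3 x p₀)) :
    ContMDiffAt (𝓘(ℝ, EuclideanSpace ℝ (Fin m)).prod (𝓡 3))
      ((𝓡 3).prod 𝓘(ℝ, E3 →L[ℝ] E3 →L[ℝ] ℝ)) ∞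
      (fun q : EuclideanSpace ℝ (Fin m) × X ↦ TotalSpace.mk' (E3 →L[ℝ] E3 →L[ℝ] ℝ)
        (E := fun p : X ↦ TangentSpace (𝓡 3) p →L[ℝ] TangentSpace (𝓡 3) p →L[ℝ] ℝ) q.2
        (pullbackBilin (I := 𝓘(ℝ, E3)) (I' := 𝓡 3) (chartAt E3 x) (S q.1) q.2)) (c₀, p₀) := by
  have hf : ContMDiffAt (𝓡 3) 𝓘(ℝ, E3) (∞ + 1) (chartAt E3 x) p₀ := by
    have h : ((∞ : ℕ∞ω) + 1) = ∞ := rfl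
    rw [h]
    exact (contMDiffOn_chart (I := 𝓡 3) (x := x) (n := ∞)).contMDiffAt
      ((chartAt E3 x).open_source.mem_nhds hp₀)
  have hs : ContMDiffAt (𝓘(ℝ, EuclideanSpace ℝ (Fin m)).prod (𝓡 3))
      ((𝓡 3).prod 𝓘(ℝ, E3 →L[ℝ] E3 →L[ℝ] ℝ)) ∞
      (fun q : EuclideanSpace ℝ (Fin m) × E3 ↦ TotalSpace.mk' (E3 →L[ℝ] E3 →L[ℝ] ℝ)
        (E := fun z : E3 ↦ TangentSpace (𝓡 3) z →L[ℝ] TangentSpace (𝓡 3) z →L[ℝ] ℝ) q.2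
        (S q.1 q.2)) (c₀, chartAt E3 x p₀) := by
    rw [contMDiffAt_bilinE3_iff]
    refine ⟨contMDiffAt_snd, ?_⟩
    have h2 : ContMDiffAt 𝓘(ℝ, EuclideanSpace ℝ (Fin m) × E3) 𝓘(ℝ, E3 →L[ℝ] E3 →L[ℝ] ℝ) ∞
        (fun q : EuclideanSpace ℝ (Fin m) × E3 ↦ S q.1 q.2) (c₀, chartAt E3 x p₀) :=
      contMDiffAt_iff_contDiffAt.2 hS
    rw [← modelWithCornersSelf_prod, chartedSpaceSelf_prod]
    exact h2
  exact PseudoRiemannianMetric.contMDiffAt_pullbackBilin_family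
    (IP := 𝓘(ℝ, EuclideanSpace ℝ (Fin m))) (q₀ := (c₀, p₀)) hf hs

end ChartInverse

end Literature.Geometry.Lorentzian

end
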